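import Summits.ResolutionOfSingularities.ResolutionOfSingularities.Theorems.PurelyInseparableDim4JointWaitingNodeDefsTwo
import Summits.ResolutionOfSingularities.ResolutionOfSingularities.Theorems.PurelyInseparableDim4JointWaitingRootHost
import Summits.ResolutionOfSingularities.ResolutionOfSingularities.Theorems.PurelyInseparableDim4JointForestRootWaitingMembers
import HarnessLib

/-!
# Purely inseparable four-folds: `MemberData` of a ROOT HOST with waiting members, in model terms (brick S3 (c) «joint
# point∘coordinate chains», part 55a = v3 threading, root host datum; cell `res-dim4-pi`)

[OURS · counted 0] (D-0157 DOOR 2; desk WORD #66 (4)(c), #74 (g), #99 (d); frame `PIDim4.TerminationImpliesOrderReduction`, S3 (c) v3;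
host item stmt-ResolutionOfSingularities-16155, helper). Nothing here proves resolution of singularities in dimension ≥ 4 / characteristic
`p` — NOT here, not anywhere in this programme.

The model-level input of the threading node theorem (part 54) at the ROOT `(𝔸⁵, (z^p + F)·𝒪, ∅)`: a translated coordinate host
`V(z^p + F, x_i − b_i : i ∈ S)` (part 38a's `root_host_package`: chart `φ` = re-centring at the rational point over `b` followed by
cleaning, `ψ = 𝟙`) with waiting entries `Wt` in ROOT FORM carries `MemberData` (part 49b) with the regions
`wr (j, c, T) = φ(W_T^c) = {x_i = b_i + c_i : i ∈ T}`; with the coordinate descriptions of the host and of the regions that turn the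
node theorem's set-level separations into inequalities of parameters.

* `isClosed_waitingSet` — `W_T^c` is closed (a zero locus);
* `isClosed_image_of_surjective` — a surjective open immersion is a closed map;
* **`root_host_memberData`**.

AI-produced formalisation, weaker than expert review. bears_on: LADDER-RESOLUTION:D157-DOOR2 (res-dim4-pi · S3 (c) joint v3 · threading).
-/

set_option linter.dupNamespace false -- D-0017: single-problem summit path `Summit.<S>.<S>.…` by design

noncomputable section

open MvPolynomial Finset CategoryTheory AlgebraicGeometry Opposite TopologicalSpace
open AlgebraicGeometry.Scheme.IdealSheafData (ofIdealTop vanishingIdeal)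

namespace Summit.ResolutionOfSingularities.ResolutionOfSingularities.Theorems.PIDim4

open Literature.AlgebraicGeometry.Resolution
open Literature.AlgebraicGeometry.Resolution.Hauser2010
open Literature.AlgebraicGeometry.Resolution.AffinePointBlowup (P A γ coord Wtop ξ)

namespace Equimultiple

section RootHostData

variable {K : Type} [Field K] {p : ℕ} [hp : Fact p.Prime] [CharP K p]

omit hp [CharP K p] in
/-- The waiting coordinate set `W_T^c = {x | x_i − c_i ∈ 𝔭_x (i ∈ T)}` is closed: it is the zero locus of the `x_i − c_i`.
[cite: StacksProject, Tag 00E0 (closed subsets of Spec = zero loci)] -/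
theorem isClosed_waitingSet (wt : Fin 4 × (Fin 4 → K) × Finset (Fin 4)) : IsClosed (waitingSet (K := K) wt) := by
  have h : waitingSet (K := K) wt =
      PrimeSpectrum.zeroLocus ((fun i : Fin 4 => (X i.succ - C (wt.2.1 i) : A 4 K)) '' (wt.2.2 : Set (Fin 4))) := by
    ext x
    rw [mem_waitingSet_iff]
    show _ ↔ (fun i : Fin 4 => (X i.succ - C (wt.2.1 i) : A 4 K)) '' (wt.2.2 : Set (Fin 4)) ⊆ (x.asIdeal : Set (A 4 K))
    rw [Set.image_subset_iff]
    rfl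
  rw [h]
  exact PrimeSpectrum.isClosed_zeroLocus _

omit hp [CharP K p] in
/-- A surjective open immersion is an isomorphism, hence a closed map. [cite: StacksProject, Tag 01IO] -/
theorem isClosed_image_of_surjective (φ : P 4 K ⟶ P 4 K) [IsOpenImmersion φ] (hsurj : Function.Surjective φ)
    (T : Set (P 4 K)) (hT : IsClosed T) : IsClosed (φ '' T) := by
  haveI : Epi φ.base := (TopCat.epi_iff_surjective _).mpr hsurj
  haveI : IsIso φ := IsOpenImmersion.isIso φ
  exact (Scheme.homeoOfIso (asIso φ)).isClosedMap T hT

/-- **`MemberData` OF A ROOT HOST WITH WAITING MEMBERS (model terms).** For the root marked ideal `((z^p + F)·𝒪, ∅, p)` on `𝔸⁵`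
and a translated coordinate host `(b, S)` (state `s = (deletePthPowers (F(x + b)), 0, ∅)`, `S` permissible) with waiting entries
`Wt` in root form (`j ∈ S`, `c|_S = 0`, `S ∖ {j} ⊆ T`, `j ∉ T`, `T` permissible for `s.F(x + c)`, `Acc` at the kid pair), own block,
hereditary block, `Acc`, and the same-chart separations: the host `c₀` of part 38a carries `MemberData` with the regions
`wr wt = φ(W wt)`; moreover `x ∈ c₀ ⇒ x_i = b_i (i ∈ S)`, closed points of the hypersurface with `x_i = b_i (i ∈ S)` lie on `c₀`,
and `x ∈ wr (j, c, T) ⟺ x_i = b_i + c_i (i ∈ T)`. [cite: BierstoneGrigorievMilmanWlodarczyk2011, Def. 3.1.3]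
[cite: Hauser2010, §G] [cite: HauserPerlega2019PRIMS, §2 (permissible centres P = (z, x_i : i ∈ Γ))] -/
theorem root_host_memberData [IsAlgClosed K] [DecidableEq K] (F : MvPolynomial (Fin 4) K) (hF : F ≠ 0)
    (hclean : Literature.Barriers.ResolutionOfSingularities.HauserPerlega.IsClean p F)
    (plan : State K → Finset (Fin 4) → Finset (Fin 4 × (Fin 4 → K) × Finset (Fin 4)))
    (leaves : State K → Finset (Fin 4) → Finset (Fin 4 × (Fin 4 → K)))
    (b : Fin 4 → K) (S : Finset (Fin 4)) (s : State K) (hs : s = ⟨deletePthPowers p (PointBlowup.translate b F), 0, ∅⟩)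
    (hS : IsPermissibleCentre p S s.F) (Wt : Finset (Fin 4 × (Fin 4 → K) × Finset (Fin 4)))
    (hown : OwnBlock p plan leaves Wt (s, S))
    (hbelow : ∀ q : State K × Finset (Fin 4),
      ((∃ e ∈ plan s S, Relation.ReflTransGen (fun q q' : State K × Finset (Fin 4) =>
          ∃ e ∈ plan q.1 q.2, q' = (CentreBlowup.step p q.2 e.1 e.2.1 q.1, e.2.2)) (CentreBlowup.step p S e.1 e.2.1 s, e.2.2) q) ∨
        ∃ wt ∈ Wt, Relation.ReflTransGen (fun q q' : State K × Finset (Fin 4) =>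
          ∃ e ∈ plan q.1 q.2, q' = (CentreBlowup.step p q.2 e.1 e.2.1 q.1, e.2.2)) (CentreBlowup.step p S wt.1 wt.2.1 s, wt.2.2) q) →
      V2Block p plan leaves q)
    (hacc : Acc (fun q' q : State K × Finset (Fin 4) => ∃ e ∈ plan q.1 q.2, q' = (CentreBlowup.step p q.2 e.1 e.2.1 q.1, e.2.2))
      (s, S))
    (hwait : ∀ wt ∈ Wt, wt.1 ∈ S ∧ (∀ i ∈ S, wt.2.1 i = 0) ∧ S.erase wt.1 ⊆ wt.2.2 ∧ wt.1 ∉ wt.2.2 ∧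
      IsPermissibleCentre p wt.2.2 (PointBlowup.translate wt.2.1 s.F) ∧
      Acc (fun q' q : State K × Finset (Fin 4) => ∃ e ∈ plan q.1 q.2, q' = (CentreBlowup.step p q.2 e.1 e.2.1 q.1, e.2.2))
        (CentreBlowup.step p S wt.1 wt.2.1 s, wt.2.2))
    (hW2 : ∀ wt ∈ Wt, ∀ wt' ∈ Wt, wt ≠ wt' → wt.1 = wt'.1 → ∃ i ∈ wt.2.2, i ∈ wt'.2.2 ∧ wt.2.1 i ≠ wt'.2.1 i)
    (hPW : ∀ e ∈ plan s S, ∀ wt ∈ Wt, e.1 = wt.1 → ∃ i ∈ e.2.2, i ∈ wt.2.2 ∧ e.2.1 i ≠ wt.2.1 i) :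
    ∃ (c₀ : Closeds (P 4 K)) (wr : Fin 4 × (Fin 4 → K) × Finset (Fin 4) → Closeds (P 4 K)),
      MemberData p plan leaves (⟨hypSheaf p F, [], p⟩ : MarkedIdeal (P 4 K)) c₀ s S Wt wr ∧
      (∀ z : P 4 K, z ∈ (c₀ : Set (P 4 K)) → ∀ i ∈ S, (X i.succ - C (b i) : A 4 K) ∈ z.asIdeal) ∧
      (∀ z : P 4 K, IsClosed ({z} : Set (P 4 K)) → (1 : ℕ∞) ≤ idealOrder (hypSheaf p F) z →
        (∀ i ∈ S, (X i.succ - C (b i) : A 4 K) ∈ z.asIdeal) → z ∈ (c₀ : Set (P 4 K))) ∧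
      (∀ wt ∈ Wt, ∀ z : P 4 K, z ∈ (wr wt : Set (P 4 K)) ↔
        ∀ i ∈ wt.2.2, (X i.succ - C (b i + wt.2.1 i) : A 4 K) ∈ z.asIdeal) := by
  classical
  have hF₀ : s.F ≠ 0 := by rw [hs]; exact deletePthPowers_translate_ne_zero hF hclean b
  have hclean₀ : Literature.Barriers.ResolutionOfSingularities.HauserPerlega.IsClean p s.F := by
    rw [hs]; exact isClean_deletePthPowers _
  have hS' : IsPermissibleCentre p S (deletePthPowers p (PointBlowup.translate b F)) := by rw [hs] at hS; exact hS
  obtain ⟨φ, _, c₀, hsurj, hMφ, hcoord', -, hreg₀, hsnc₀, hZ₀, hin₀, hon₀⟩ := root_host_package (p := p) F b hS'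
  have hM : (⟨hypSheaf p F, [], p⟩ : MarkedIdeal (P 4 K)).ideal.comap φ = (hypSheaf p s.F).comap (𝟙 (P 4 K)) := by
    rw [Scheme.IdealSheafData.comap_id, hs]; exact hMφ
  have hZφ : (vanishingIdeal c₀).comap φ =
      (AffineCoordBlowup.𝓘Λ 4 K (insert 0 (Fin.succ '' (S : Set (Fin 4))))).comap (𝟙 (P 4 K)) := by
    rw [Scheme.IdealSheafData.comap_id]; exact hZ₀
  have hnil : ∀ D : (P 4 K).IdealSheafData, D ∉ (⟨hypSheaf p F, [], p⟩ : MarkedIdeal (P 4 K)).boundary :=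
    fun D hD => (List.mem_nil_iff D).mp hD
  set wr : Fin 4 × (Fin 4 → K) × Finset (Fin 4) → Closeds (P 4 K) := fun wt =>
    ⟨φ '' waitingSet wt, isClosed_image_of_surjective φ hsurj _ (isClosed_waitingSet wt)⟩ with hwr
  refine ⟨c₀, wr, ⟨hF₀, hclean₀, hS, hreg₀, hsnc₀, ⟨P 4 K, φ, 𝟙 _, inferInstance, inferInstance, hM, hZφ,
    fun z _ => hsurj z, fun y _ => ⟨y, rfl⟩, ⟨fun _ => 0, fun _ => 0, fun D hD _ => absurd hD (hnil D),
      fun D₁ hD₁ _ _ _ _ _ => absurd hD₁ (hnil D₁)⟩, fun wt _ => ⟨rfl, fun y _ => ⟨y, rfl⟩⟩⟩,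
    hown, hbelow, hacc, fun wt hwt => ?_, hW2, hPW⟩, hin₀, hon₀, fun wt _ z => ?_⟩
  · -- waiting data in kid form
    obtain ⟨hj, hc0, hsub, hjT, hperm, haccw⟩ := hwait wt hwt
    exact ⟨hj, hc0, hsub, hjT, isPermissibleCentre_step_of_not_mem hj hjT hc0 s hperm, haccw,
      fun D hD => absurd hD (hnil D)⟩
  · -- coordinate description of the region
    change z ∈ φ '' waitingSet wt ↔ _
    refine ⟨?_, fun hz => ?_⟩
    · rintro ⟨y, hy, rfl⟩
      exact fun i hi => (hcoord' y i (wt.2.1 i)).mpr ((mem_waitingSet_iff wt y).mp hy i hi)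
    · obtain ⟨y, rfl⟩ := hsurj z
      exact ⟨y, (mem_waitingSet_iff wt y).mpr fun i hi => (hcoord' y i (wt.2.1 i)).mp (hz i hi), rfl⟩

end RootHostData

end Equimultiple

end Summit.ResolutionOfSingularities.ResolutionOfSingularities.Theorems.PIDim4

end
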